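import Literature.MathematicalPhysics.QuantumLattice.DWaveOrderParameterInfiniteVolume
import Literature.MathematicalPhysics.QuantumLattice.DWaveOrderParameterRightDerivative
import Mathlib.Analysis.Convex.Continuous
import HarnessLib

/-!
# The thermodynamic-limit RESPONSE FUNCTION `m(h) = −∂⁺e_src(h)/2` of the `t–t'` pinning-field programme:
# monotone, right-continuous, `→ m*` as `h → 0⁺`, equal to the largest pair amplitude of a translation-invariant
# sourced ground state at `h`, and to `lim_L m_{L+1}(h)` off a countable set

Topic `Literature/MathematicalPhysics/QuantumLattice` (namespace = path). The `t' ≠ 0` TWIN of the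
`§ResponseFunction` block of `DWaveOrderParameterRightDerivative.lean` (hubbard-cq-p5, `t' = 0`), now for
`E := dWaveSourceEnergyDensityTT' t' U μ` (hubbard-cq-obsth-2) and `m* := dWaveOrderParameterTT' t' U μ`, plus
the one generic fact it rests on — Rockafellar's Thm. 24.1: the right derivative of a convex function on `ℝ`
is right-continuous — and the infinite-volume reading from `DWaveOrderParameterInfiniteVolume.lean`
(hubbard-cq-p5). Hubbard cuprate cell (`hubbard-cq`), rung CQ, rows PC-a / PC-c; both anchors (`t'` is a
parameter). Everything is PROVED; no definition, no named fact, zero compute.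

## Contents (`m(h) := −(derivWithin E (Ioi h) h)/2`)

* `tendsto_rightDeriv_nhdsGT_of_convexOn_univ` (generic): for `f` convex on `ℝ`,
  `derivWithin f (Ioi x) x → derivWithin f (Ioi a) a` as `x → a⁺`. [Rockafellar 1970, Thm. 24.1]
* `monotone_neg_half_rightDeriv_dWaveSourceEnergyDensityTT'`: `m` is non-decreasing;
  `dWaveOrderParameterTT'_le_neg_half_rightDeriv`: `m* ≤ m(h)` for `h ≥ 0` (`m* = m(0)`);
  **`tendsto_neg_half_rightDeriv_dWaveSourceEnergyDensityTT'_nhdsGT`: `m(h) → m*` as `h → 0⁺`** and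
  `…_nhdsGT_of` : `m` is right-continuous at every `h`.
* `isGreatest_re_expect_localPairAt_sourcedGroundStates`: **`m(h)` IS the greatest `d`-wave pair amplitude
  `Re ω(P₀^d)` of a translation-invariant sourced ground state at `h`** (mean-energy minimiser of
  `hubbardTTPrimeSourcedInteraction 1 t' U μ dWaveFormFactor h`); `isLeast_…` with `−(derivWithin E (Iio h) h)/2`.
* `tendsto_dWaveSourceDensityTT'_of_differentiableAt`: at a differentiability point of `E` the finite-torus
  sourced densities converge, `m_{L+1}(h) → m(h)`; `countable_not_tendsto_dWaveSourceDensityTT'`: this fails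
  for at most countably many `h`.

So every finite-`h` reading of the programme at the `t' = −1/4` anchor — the stair `liminf_L m_{L+1}(h)`, the
secant `(E(0) − E(h))/(2h)`, the response function `m(h)`, the largest TI sourced ground-state amplitude — is
`≥ m*` and tends to `m*` at `0⁺`; a floor on `m*` still needs a MODULUS for that convergence (census).

## References
* R. T. Rockafellar, *Convex Analysis* (1970), Thm. 24.1 (one-sided derivatives of convex functions:
  monotone, `f'₊` right-continuous), Thm. 25.3. [cite: Rockafellar1970, Thm. 24.1]
* T. Koma, H. Tasaki, J. Stat. Phys. 76 (1994) 745–803, §1. [cite: KomaTasaki1994, §1]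
* R. B. Griffiths, Phys. Rev. 152 (1966) 240–246, §II. [cite: Griffiths1966, §II]
-/

noncomputable section

namespace Literature.MathematicalPhysics.QuantumLattice

open _root_.Filter Set Literature.Probability.LatticeModels HubbardWave0
open scoped _root_.Topology

/-! ### Generic: the right derivative of a convex function is right-continuous -/

/-- **Rockafellar's Theorem 24.1 (right-continuity of the right derivative)**: for `f` convex on `ℝ`,
`x ↦ ∂⁺f(x) = derivWithin f (Ioi x) x` is right-continuous at every `a`: it is monotone, so
`∂⁺f(x) ≥ ∂⁺f(a)` for `x > a`, and `∂⁺f(x) ≤ slope f x t → slope f a t` (`x → a⁺`, continuity of `f`) for every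
`t > a`, while `slope f a t → ∂⁺f(a)` as `t → a⁺`. [cite: Rockafellar1970, Thm. 24.1] -/
theorem tendsto_rightDeriv_nhdsGT_of_convexOn_univ {f : ℝ → ℝ} (hfc : ConvexOn ℝ Set.univ f) (a : ℝ) :
    Tendsto (fun x : ℝ => derivWithin f (Ioi x) x) (𝓝[>] a) (𝓝 (derivWithin f (Ioi a) a)) := by
  have hint : ∀ x : ℝ, x ∈ interior (Set.univ : Set ℝ) := fun x => by
    rw [interior_univ]
    exact Set.mem_univ x
  have hmono : Monotone fun x : ℝ => derivWithin f (Ioi x) x := by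
    have key := hfc.monotoneOn_rightDeriv
    rw [interior_univ] at key
    exact monotoneOn_univ.1 key
  -- the right slopes at `a` tend to `∂⁺f(a)`
  have hslope : Tendsto (slope f a) (𝓝[>] a) (𝓝 (derivWithin f (Ioi a) a)) :=
    (hasDerivWithinAt_iff_tendsto_slope' self_notMem_Ioi).1
      (hfc.hasDerivWithinAt_rightDeriv_of_mem_interior (hint a))
  -- `f` is continuous
  have hcont : Continuous f := hfc.locallyLipschitz.continuous
  rw [tendsto_order]
  constructor
  · -- lower bound: monotonicity
    intro b hb
    exact eventually_nhdsWithin_of_forall fun x hx => hb.trans_le (hmono (le_of_lt hx))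
  · -- upper bound: a chord slope from `a`, then continuity of the chord in its left endpoint
    intro b hb
    obtain ⟨t, hslt, hat⟩ := (((tendsto_order.1 hslope).2 b hb).and self_mem_nhdsWithin).exists
    have hat' : a < t := hat
    -- `x ↦ slope f x t` is continuous at `a`
    have hsl : Tendsto (fun x : ℝ => slope f x t) (𝓝[>] a) (𝓝 (slope f a t)) := by
      have h1 : ContinuousAt (fun x : ℝ => slope f x t) a := by
        have e1 : (fun x : ℝ => slope f x t) = fun x => (t - x)⁻¹ * (f t - f x) := by
          funext x
          rw [slope_def_field, div_eq_inv_mul]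
        rw [e1]
        refine ContinuousAt.mul ?_ ?_
        · exact (continuousAt_const.sub continuousAt_id).inv₀ (sub_ne_zero.2 hat'.ne')
        · exact continuousAt_const.sub hcont.continuousAt
      exact h1.tendsto.mono_left nhdsWithin_le_nhds
    have hev1 : ∀ᶠ x in 𝓝[>] a, slope f x t < b := (tendsto_order.1 hsl).2 b hslt
    have hev2 : ∀ᶠ x in 𝓝[>] a, x < t := by
      filter_upwards [Ioo_mem_nhdsGT hat'] with x hx using hx.2
    filter_upwards [hev1, hev2] with x hx1 hx2
    exact (hfc.rightDeriv_le_slope (Set.mem_univ x) (Set.mem_univ t) hx2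
      (hfc.differentiableWithinAt_Ioi_of_mem_interior (hint x))).trans_lt hx1

/-! ### The response function of the `t–t'` model -/

section ResponseFunction

variable (t' U μ : ℝ)

/-- **The thermodynamic-limit response function `m(h) := −∂⁺E(h)/2` is non-decreasing on `ℝ`** (concavity
of `E`). [cite: KomaTasaki1994, §1] -/
theorem monotone_neg_half_rightDeriv_dWaveSourceEnergyDensityTT' :
    Monotone fun h : ℝ => -derivWithin (dWaveSourceEnergyDensityTT' t' U μ) (Ioi h) h / 2 := by
  have key := (concaveOn_dWaveSourceEnergyDensityTT' t' U μ).neg.monotoneOn_rightDeriv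
  rw [interior_univ] at key
  have e1 : (-fun h : ℝ => dWaveSourceEnergyDensityTT' t' U μ h) = -dWaveSourceEnergyDensityTT' t' U μ := rfl
  intro h h' hle
  have := monotoneOn_univ.1 key hle
  simp only [e1, derivWithin.neg] at this
  dsimp only
  linarith

/-- **`m* ≤ m(h)` for every `h ≥ 0`** (`m* = m(0)` and monotonicity). [cite: KomaTasaki1994, §1] -/
theorem dWaveOrderParameterTT'_le_neg_half_rightDeriv {h : ℝ} (hh : 0 ≤ h) :
    dWaveOrderParameterTT' t' U μ ≤ -derivWithin (dWaveSourceEnergyDensityTT' t' U μ) (Ioi h) h / 2 := by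
  rw [dWaveOrderParameterTT'_eq_neg_half_rightDeriv]
  exact monotone_neg_half_rightDeriv_dWaveSourceEnergyDensityTT' t' U μ hh

/-- **`m` is right-continuous at every source**: `m(x) → m(h)` as `x → h⁺` (Rockafellar 24.1 for `−E`).
[cite: Rockafellar1970, Thm. 24.1] -/
theorem tendsto_neg_half_rightDeriv_dWaveSourceEnergyDensityTT'_nhdsGT_of (h : ℝ) :
    Tendsto (fun x : ℝ => -derivWithin (dWaveSourceEnergyDensityTT' t' U μ) (Ioi x) x / 2) (𝓝[>] h)
      (𝓝 (-derivWithin (dWaveSourceEnergyDensityTT' t' U μ) (Ioi h) h / 2)) := by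
  have key := tendsto_rightDeriv_nhdsGT_of_convexOn_univ (concaveOn_dWaveSourceEnergyDensityTT' t' U μ).neg h
  have e1 : (-fun x : ℝ => dWaveSourceEnergyDensityTT' t' U μ x) = -dWaveSourceEnergyDensityTT' t' U μ := rfl
  simp only [e1, derivWithin.neg] at key
  have key2 := key.div_const 2
  refine key2.congr fun x => ?_
  ring

/-- **Every finite-`h` reading has the same limit at `0⁺`: `m(h) → m*` as `h → 0⁺`.** [cite: KomaTasaki1994, §1] -/
theorem tendsto_neg_half_rightDeriv_dWaveSourceEnergyDensityTT'_nhdsGT :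
    Tendsto (fun h : ℝ => -derivWithin (dWaveSourceEnergyDensityTT' t' U μ) (Ioi h) h / 2) (𝓝[>] 0)
      (𝓝 (dWaveOrderParameterTT' t' U μ)) := by
  rw [dWaveOrderParameterTT'_eq_neg_half_rightDeriv]
  exact tendsto_neg_half_rightDeriv_dWaveSourceEnergyDensityTT'_nhdsGT_of t' U μ 0

/-- **`m(h)` IS the greatest `d`-wave pair amplitude of a translation-invariant sourced ground state at `h`**:
the set `{Re ω(P₀^d) : ω a mean-energy minimiser of the sourced interaction at h}` has greatest element
`−∂⁺E(h)/2`. [cite: KomaTasaki1994, §1] -/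
theorem isGreatest_re_expect_localPairAt_sourcedGroundStates (h : ℝ) :
    IsGreatest ((fun ω : InfVolFermionState 2 => (ω.expect (pairRegion (insert (0 : Site 2) unitSteps) 0)
        (localPairAt (insert 0 unitSteps) dWaveFormFactor 0)).re) ''
        {ω | ω.IsMeanEnergyMinimiser (hubbardTTPrimeSourcedInteraction 1 t' U μ dWaveFormFactor h) 1})
      (-derivWithin (dWaveSourceEnergyDensityTT' t' U μ) (Ioi h) h / 2) := by
  obtain ⟨ω, hω, hωe⟩ := exists_isMeanEnergyMinimiser_two_mul_re_expect_localPairAt_eq_neg_rightDeriv t' U μ h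
  refine ⟨⟨ω, hω, ?_⟩, ?_⟩
  · dsimp only
    linarith
  · rintro _ ⟨ω', hω', rfl⟩
    have := hω'.two_mul_re_expect_localPairAt_mem_Icc.2
    dsimp only
    linarith

/-- … and least element `−∂⁻E(h)/2`. [cite: KomaTasaki1994, §1] -/
theorem isLeast_re_expect_localPairAt_sourcedGroundStates (h : ℝ) :
    IsLeast ((fun ω : InfVolFermionState 2 => (ω.expect (pairRegion (insert (0 : Site 2) unitSteps) 0)
        (localPairAt (insert 0 unitSteps) dWaveFormFactor 0)).re) ''
        {ω | ω.IsMeanEnergyMinimiser (hubbardTTPrimeSourcedInteraction 1 t' U μ dWaveFormFactor h) 1})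
      (-derivWithin (dWaveSourceEnergyDensityTT' t' U μ) (Iio h) h / 2) := by
  obtain ⟨ω, hω, hωe⟩ := exists_isMeanEnergyMinimiser_two_mul_re_expect_localPairAt_eq_neg_leftDeriv t' U μ h
  refine ⟨⟨ω, hω, ?_⟩, ?_⟩
  · dsimp only
    linarith
  · rintro _ ⟨ω', hω', rfl⟩
    have := hω'.two_mul_re_expect_localPairAt_mem_Icc.1
    dsimp only
    linarith

/-- **Off the kinks the finite-torus responses CONVERGE to the response function**: at every differentiability
point `h` of `E`, `m_{L+1}(h) → m(h)` (`m_L = dWaveSourceDensityTT' L t' U μ h`). [cite: Griffiths1966, §II] -/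
theorem tendsto_dWaveSourceDensityTT'_of_differentiableAt {h : ℝ}
    (hd : DifferentiableAt ℝ (dWaveSourceEnergyDensityTT' t' U μ) h) :
    Tendsto (fun L : ℕ => dWaveSourceDensityTT' (L + 1) t' U μ h) atTop
      (𝓝 (-derivWithin (dWaveSourceEnergyDensityTT' t' U μ) (Ioi h) h / 2)) := by
  have hderiv := hd.hasDerivAt
  have hW : derivWithin (dWaveSourceEnergyDensityTT' t' U μ) (Ioi h) h =
      deriv (dWaveSourceEnergyDensityTT' t' U μ) h :=
    hderiv.hasDerivWithinAt.derivWithin (uniqueDiffWithinAt_Ioi h)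
  rw [hW]
  exact tendsto_dWaveSourceDensityTT'_of_hasDerivAt_energyDensity t' U μ hderiv

/-- **Hence `m_{L+1}(h) → m(h)` for all but countably many sources `h`.** [cite: Griffiths1966, §II] -/
theorem countable_not_tendsto_dWaveSourceDensityTT' :
    Set.Countable {h : ℝ | ¬ Tendsto (fun L : ℕ => dWaveSourceDensityTT' (L + 1) t' U μ h) atTop
      (𝓝 (-derivWithin (dWaveSourceEnergyDensityTT' t' U μ) (Ioi h) h / 2))} := by
  have key := countable_not_differentiableAt_of_convexOn_univ (concaveOn_dWaveSourceEnergyDensityTT' t' U μ).neg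
  refine key.mono ?_
  intro h hh hd
  exact hh (tendsto_dWaveSourceDensityTT'_of_differentiableAt t' U μ (by simpa using hd.neg))

end ResponseFunction

end Literature.MathematicalPhysics.QuantumLattice

end
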